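import Literature.AlgebraicGeometry.Resolution.CoefficientIdealRestriction
import Literature.AlgebraicGeometry.Resolution.StalkIdealLemmas
import Literature.AlgebraicGeometry.Resolution.AlterationsSectionDivisor
import Literature.AlgebraicGeometry.Resolution.MarkedIdeals
import HarnessLib

/-!
# [OURS · L1 W4.5(b) · EL♮(3) · door ν4, HSUBᵉ supplier N-RD (`HRDZ`)] THE SPLIT-NODE PACKAGE SURVIVES A ROUND:
# transport of «`I_S = I_L + (u,v)`, `I_W = I_L + (g)`, `g = a u² + b uv + c v² + h`, `h ∈ I_L + (u,v)³`, `b² − 4ac` a unit» ALONG `τ^♯`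
# when the HOST and the NOSE are unchanged (`V(L₁) ≅ V(L)`, `V(W₁) ≅ V(W)` over `τ`) — `τ^♯` itself need NOT be an isomorphism

res-type-027 g21 (desk 2026-08-28T23:09Z (ii): «027 = HRDZ», the N-RD supplier `hrdz_rPlus` of ✓ `Equinodal.hsube_of_suppliers`, res-L1-w45b-nose-w1
p676659, at `RD := RPlus` of ✓ `…NatResidueHypDefsE3`). Crux `EquisingularLiftNatThree` = stmt-ResolutionOfSingularities-20148 (parent stmt-…-20038),
route `EquisingularLift`, line `sections`. OURS; NOT a statement of any manuscript ([Hironaka2017] is a candidate under adjudication, nothing of it is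
asserted); AI-written, weaker than expert review. No `sorry`, no definition, no instance; standard axioms. `--supports stmt-ResolutionOfSingularities-20148 --as helper`.

WHY. The last `NoseDatum` clause (`SplitNodeAt`, res-L1-w45b-nose-w1's DefsE3) lives in the AMBIENT stalk `𝒪_{X₁,x₁}` of the round's stage, but all
five of its conditions are conditions MODULO the host letter `L`. Along the round `τ : X₁ → X'` (blow-up of a curve `C ⊇ 𝓛` which may pass THROUGH the
node), `τ^♯ : A = 𝒪_{X',x} → A₁ = 𝒪_{X₁,x₁}` is not an isomorphism, but `A/L ≅ A₁/L₁` (host unchanged) and `A/M ≅ A₁/M₁` (nose unchanged) are — and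
that is all the transport needs (res-L1-w45b-stub-2's ✓ `exists_splitNode_map_of_ringEquiv` is the special case `τ^♯` iso, off the centre).

WHAT.
* `eq_sup_map_of_comap_eq_sup` — pure algebra: `φ : A → A₁`, `φ(L) ⊆ L₁ ⊆ I₁`, `A₁ = φ(A) + L₁`, `φ⁻¹(I₁) = L + J` ⇒ `I₁ = L₁ + φ(J)`;
  `exists_splitNode_of_quotient_transport` — the ∃-package moves along such a `φ` given `φ⁻¹(M₁) = M`, `φ⁻¹(K₁) = K`.
* scheme inputs at a point `x₁` of the stage: `exists_sub_stalkMap_mem_stalkIdeal` (`A₁ = τ^♯(A) + (I₁)_{x₁}` when `V(I₁) → X₁ → X'` is a closed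
  immersion), `comap_stalkMap_stalkIdeal_eq_of_iso_over` (`(τ^♯)⁻¹ (I₁)_{x₁} = I_{τ x₁}` when `V(I₁) ≅ V(I)` over `τ`),
  `comap_stalkMap_stalkIdeal_ker_of_comp` (`(τ^♯)⁻¹ (ker f₁)_{x₁} = (ker f)_{τ x₁}` for closed immersions `f₁ ≫ τ = f`);
* ★ `exists_splitNode_stalk_of_isos_over` — the scheme form used by `hrdz_rPlus`.

References: [StacksProject, Tags 01HJ, 080E]; [GortzWedhorn2020, Def. 13.90]; Literature (imported): `Resolution/CoefficientIdealRestriction`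
(`ker_stalkMap_subschemeι`), `Resolution/AlterationsSectionDivisor` (`stalkIdeal_ker_eq_ker_stalkMap`), `Resolution/StalkIdealLemmas`
(`stalkIdeal_comap_eq_map_stalkMap`), `Resolution/MarkedIdeals` (`stalkIdeal_mono`).
-/

set_option linter.dupNamespace false -- mandated namespace `Summit.<Summit>.<Problem>` of this single-conjunct summit

noncomputable section

open CategoryTheory AlgebraicGeometry TopologicalSpace Topology IsLocalRing
open Literature.AlgebraicGeometry.Resolution
open AlgebraicGeometry.Scheme.IdealSheafData

namespace Summit.ResolutionOfSingularities.ResolutionOfSingularities.Cruxes.EquisingularLiftNat.Sections.RoundIso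

/-! ## Pure algebra: ideals containing `L₁` are read off modulo `L` -/

section Algebra

variable {A A₁ : Type*} [CommRing A] [CommRing A₁]

/-- **`I₁ = L₁ + φ(J)`** when `φ(L) ⊆ L₁ ⊆ I₁`, `A₁ = φ(A) + L₁` and `φ⁻¹(I₁) = L + J`. [folklore] -/
theorem eq_sup_map_of_comap_eq_sup (φ : A →+* A₁) {L J : Ideal A} {L₁ I₁ : Ideal A₁} (hL : L.map φ ≤ L₁)
    (hsurj : ∀ a₁ : A₁, ∃ a : A, a₁ - φ a ∈ L₁) (hLI : L₁ ≤ I₁) (hI : I₁.comap φ = L ⊔ J) : I₁ = L₁ ⊔ J.map φ := by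
  apply le_antisymm
  · intro x₁ hx₁
    obtain ⟨a, ha⟩ := hsurj x₁
    have hφa : φ a ∈ I₁ := by
      have : φ a = x₁ - (x₁ - φ a) := by ring
      rw [this]; exact I₁.sub_mem hx₁ (hLI ha)
    have ha' : a ∈ L ⊔ J := by rw [← hI, Ideal.mem_comap]; exact hφa
    have hφa' : φ a ∈ L₁ ⊔ J.map φ := by
      have := Ideal.mem_map_of_mem φ ha'
      rw [Ideal.map_sup] at this
      exact sup_le_sup_right hL _ this
    have : x₁ = (x₁ - φ a) + φ a := by ring
    rw [this]
    exact Ideal.add_mem _ (Ideal.mem_sup_left ha) hφa'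
  · exact sup_le hLI (Ideal.map_le_iff_le_comap.mpr (by rw [hI]; exact le_sup_right))

/-- **The split-node ∃-package moves along `φ : A → A₁`** with `φ(L) ⊆ L₁ ⊆ M₁, K₁`, `A₁ = φ(A) + L₁`, `φ⁻¹(M₁) = M`, `φ⁻¹(K₁) = K` (`φ` need not be an
isomorphism: only `A/L ≅ A₁/L₁` and the two quotient squares matter). [folklore] -/
theorem exists_splitNode_of_quotient_transport (φ : A →+* A₁) {L M K : Ideal A} {L₁ M₁ K₁ : Ideal A₁} (hL : L.map φ ≤ L₁)
    (hsurj : ∀ a₁ : A₁, ∃ a : A, a₁ - φ a ∈ L₁) (hLM : L₁ ≤ M₁) (hLK : L₁ ≤ K₁) (hM : M₁.comap φ = M) (hK : K₁.comap φ = K)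
    (h : ∃ (u v g a b c h : A), K = L ⊔ Ideal.span {u, v} ∧ M = L ⊔ Ideal.span {g} ∧
      g = a * u ^ 2 + b * u * v + c * v ^ 2 + h ∧ h ∈ L ⊔ Ideal.span {u, v} ^ 3 ∧ IsUnit (b ^ 2 - 4 * a * c)) :
    ∃ (u v g a b c h : A₁), K₁ = L₁ ⊔ Ideal.span {u, v} ∧ M₁ = L₁ ⊔ Ideal.span {g} ∧
      g = a * u ^ 2 + b * u * v + c * v ^ 2 + h ∧ h ∈ L₁ ⊔ Ideal.span {u, v} ^ 3 ∧ IsUnit (b ^ 2 - 4 * a * c) := by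
  obtain ⟨u, v, g, a, b, c, h, hS, hW, hg, hh, hunit⟩ := h
  refine ⟨φ u, φ v, φ g, φ a, φ b, φ c, φ h, ?_, ?_, ?_, ?_, ?_⟩
  · rw [eq_sup_map_of_comap_eq_sup φ hL hsurj hLK (hK.trans hS), Ideal.map_span, Set.image_pair]
  · rw [eq_sup_map_of_comap_eq_sup φ hL hsurj hLM (hM.trans hW), Ideal.map_span, Set.image_singleton]
  · rw [hg]; simp only [map_add, map_mul, map_pow]
  · have := Ideal.mem_map_of_mem φ hh
    rw [Ideal.map_sup, Ideal.map_pow, Ideal.map_span, Set.image_pair] at this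
    exact sup_le_sup_right hL _ this
  · have := hunit.map φ
    simpa only [map_sub, map_mul, map_pow, map_ofNat] using this

end Algebra

/-! ## The three scheme inputs at a point of the stage -/

section Stalks

universe u

variable {X X₁ : Scheme.{u}} (τ : X₁ ⟶ X)

/-- **`A₁ = τ^♯(A) + (I₁)_{x₁}`** at a point `x₁ ∈ V(I₁)` when `V(I₁) → X₁ → X` is a closed immersion (e.g. `= e ≫ ι` for an iso `e : V(I₁) ≅ V(I)`
over `τ`): its stalk map is onto, and `ker (𝒪_{X₁,x₁} → 𝒪_{V(I₁)}) = (I₁)_{x₁}`. [folklore] -/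
theorem exists_sub_stalkMap_mem_stalkIdeal (I₁ : X₁.IdealSheafData) [IsClosedImmersion (I₁.subschemeι ≫ τ)] (x₁ : X₁)
    (hx₁ : x₁ ∈ (I₁.support : Set X₁)) (a₁ : X₁.presheaf.stalk x₁) :
    ∃ a : X.presheaf.stalk (τ x₁), a₁ - (τ.stalkMap x₁).hom a ∈ stalkIdeal I₁ x₁ := by
  rw [← range_subschemeι] at hx₁
  obtain ⟨z₁, rfl⟩ := hx₁
  obtain ⟨a, ha⟩ := (I₁.subschemeι ≫ τ).stalkMap_surjective z₁ ((I₁.subschemeι.stalkMap z₁).hom a₁)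
  refine ⟨a, ?_⟩
  rw [← ker_stalkMap_subschemeι, RingHom.mem_ker, map_sub, sub_eq_zero]
  rw [Scheme.Hom.stalkMap_comp] at ha
  change (I₁.subschemeι.stalkMap z₁).hom ((τ.stalkMap _).hom a) = _ at ha
  exact ha.symm

/-- **`(τ^♯)⁻¹ (I₁)_{x₁} = I_{τ x₁}`** at `x₁ ∈ V(I₁)` when `e : V(I₁) ≅ V(I)` lies over `τ` (`e ≫ ι = ι₁ ≫ τ`): both sides are the kernel of
`𝒪_{X, τ x₁} → 𝒪_{V(I₁), z₁} ≅ 𝒪_{V(I), e z₁}`. [folklore] -/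
theorem comap_stalkMap_stalkIdeal_eq_of_iso_over (I₁ : X₁.IdealSheafData) (I : X.IdealSheafData) (e : I₁.subscheme ≅ I.subscheme)
    (he : e.hom ≫ I.subschemeι = I₁.subschemeι ≫ τ) (x₁ : X₁) (hx₁ : x₁ ∈ (I₁.support : Set X₁)) :
    (stalkIdeal I₁ x₁).comap (τ.stalkMap x₁).hom = stalkIdeal I (τ x₁) := by
  rw [← range_subschemeι] at hx₁
  obtain ⟨z₁, rfl⟩ := hx₁
  have key : ∀ f : I₁.subscheme ⟶ X, f = e.hom ≫ I.subschemeι → RingHom.ker (f.stalkMap z₁).hom = stalkIdeal I (f z₁) := by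
    rintro f rfl
    rw [Scheme.Hom.stalkMap_comp]
    change RingHom.ker ((e.hom.stalkMap z₁).hom.comp (I.subschemeι.stalkMap (e.hom z₁)).hom) = _
    have hinj : Function.Injective (e.hom.stalkMap z₁).hom := (asIso (e.hom.stalkMap z₁)).commRingCatIsoToRingEquiv.injective
    ext a
    rw [RingHom.mem_ker, RingHom.comp_apply, map_eq_zero_iff _ hinj, ← RingHom.mem_ker, ker_stalkMap_subschemeι]
    exact Iff.rfl
  rw [← ker_stalkMap_subschemeι, RingHom.comap_ker, ← CommRingCat.hom_comp, ← Scheme.Hom.stalkMap_comp]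
  exact key _ he.symm

/-- **`(τ^♯)⁻¹ (ker f₁)_{f₁ p} = (ker f)_{τ (f₁ p)}`** for closed immersions `f₁ : S → X₁`, `f = f₁ ≫ τ : S → X`: both are the kernel of
`𝒪_{X, f p} → 𝒪_{S, p}`. [folklore] -/
theorem comap_stalkMap_stalkIdeal_ker_of_comp {S : Scheme.{u}} (f₁ : S ⟶ X₁) [IsClosedImmersion f₁] (f : S ⟶ X) [IsClosedImmersion f]
    (hf : f₁ ≫ τ = f) (p : S) :
    (stalkIdeal f₁.ker (f₁ p)).comap (τ.stalkMap (f₁ p)).hom = stalkIdeal f.ker (τ (f₁ p)) := by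
  subst hf
  rw [stalkIdeal_ker_eq_ker_stalkMap f₁ p, RingHom.comap_ker, ← CommRingCat.hom_comp, ← Scheme.Hom.stalkMap_comp]
  exact (stalkIdeal_ker_eq_ker_stalkMap (f₁ ≫ τ) p).symm

/-- ★ **THE SPLIT-NODE PACKAGE SURVIVES A ROUND.** `τ : X₁ → X` with `𝓛·𝒪_{X₁} ⊆ 𝓛₁ ⊆ 𝓦₁ ⊆ ker f₁`; the host unchanged (`V(𝓛₁) → X₁ → X` a closed
immersion), the nose unchanged (`eW : V(𝓦₁) ≅ V(𝓦)` over `τ`), the section lifted (`f₁ ≫ τ = f`, closed immersions). Then the package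
«`(ker f)_x = 𝓛_x + (u,v)`, `𝓦_x = 𝓛_x + (g)`, `g = a u² + b uv + c v² + h`, `h ∈ 𝓛_x + (u,v)³`, `b² − 4ac ∈ A^×`» at `x = τ x₁` gives the same package
for `(ker f₁)_{x₁}, (𝓦₁)_{x₁}, (𝓛₁)_{x₁}` at `x₁ = f₁ p` (images under `τ^♯`). [folklore] -/
theorem exists_splitNode_stalk_of_isos_over (𝓛 𝓦 : X.IdealSheafData) (𝓛₁ 𝓦₁ : X₁.IdealSheafData) (hL : 𝓛.comap τ ≤ 𝓛₁) (hLW₁ : 𝓛₁ ≤ 𝓦₁)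
    [IsClosedImmersion (𝓛₁.subschemeι ≫ τ)] (eW : 𝓦₁.subscheme ≅ 𝓦.subscheme) (heW : eW.hom ≫ 𝓦.subschemeι = 𝓦₁.subschemeι ≫ τ)
    {S : Scheme.{u}} (f₁ : S ⟶ X₁) [IsClosedImmersion f₁] (f : S ⟶ X) [IsClosedImmersion f] (hf : f₁ ≫ τ = f) (hWf₁ : 𝓦₁ ≤ f₁.ker)
    (p : S) (x₁ : X₁) (hx₁ : x₁ = f₁ p) (hx₁W : x₁ ∈ (𝓦₁.support : Set X₁))
    (h : ∃ (u v g a b c h : X.presheaf.stalk (τ x₁)), stalkIdeal f.ker (τ x₁) = stalkIdeal 𝓛 (τ x₁) ⊔ Ideal.span {u, v} ∧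
      stalkIdeal 𝓦 (τ x₁) = stalkIdeal 𝓛 (τ x₁) ⊔ Ideal.span {g} ∧ g = a * u ^ 2 + b * u * v + c * v ^ 2 + h ∧
      h ∈ stalkIdeal 𝓛 (τ x₁) ⊔ Ideal.span {u, v} ^ 3 ∧ IsUnit (b ^ 2 - 4 * a * c)) :
    ∃ (u v g a b c h : X₁.presheaf.stalk x₁), stalkIdeal f₁.ker x₁ = stalkIdeal 𝓛₁ x₁ ⊔ Ideal.span {u, v} ∧
      stalkIdeal 𝓦₁ x₁ = stalkIdeal 𝓛₁ x₁ ⊔ Ideal.span {g} ∧ g = a * u ^ 2 + b * u * v + c * v ^ 2 + h ∧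
      h ∈ stalkIdeal 𝓛₁ x₁ ⊔ Ideal.span {u, v} ^ 3 ∧ IsUnit (b ^ 2 - 4 * a * c) := by
  have hx₁L : x₁ ∈ (𝓛₁.support : Set X₁) := support_antitone hLW₁ hx₁W
  have hLmap : (stalkIdeal 𝓛 (τ x₁)).map (τ.stalkMap x₁).hom ≤ stalkIdeal 𝓛₁ x₁ := by
    rw [← stalkIdeal_comap_eq_map_stalkMap]; exact stalkIdeal_mono hL _
  have hK : (stalkIdeal f₁.ker x₁).comap (τ.stalkMap x₁).hom = stalkIdeal f.ker (τ x₁) := by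
    subst hx₁; exact comap_stalkMap_stalkIdeal_ker_of_comp τ f₁ f hf p
  exact exists_splitNode_of_quotient_transport (τ.stalkMap x₁).hom hLmap (exists_sub_stalkMap_mem_stalkIdeal τ 𝓛₁ x₁ hx₁L)
    (stalkIdeal_mono hLW₁ _) (stalkIdeal_mono (hLW₁.trans hWf₁) _) (comap_stalkMap_stalkIdeal_eq_of_iso_over τ 𝓦₁ 𝓦 eW heW x₁ hx₁W) hK h

end Stalks

end Summit.ResolutionOfSingularities.ResolutionOfSingularities.Cruxes.EquisingularLiftNat.Sections.RoundIso

end
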